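import Summits.CriticalPhenomena.PercolationContinuityZ3.Theorems.Transplant.FKConnectivityAllQPat3KNetBridge
import HarnessLib

/-!
# Connectivity correlation inequalities for `φ_{w,q}`, every `q > 0` — THEOREM 𝒯₂(𝒦), THE BRIDGE CASE, part 4:
# the inner mark AT THE INNER VERTEX `c` (row B0 in all thirty-two {free, contracted} states; census g39 §3 / census g41)

Proof file (`--supports stmt-CriticalPhenomena-4575`), census lineage (gen 41) of LANE 2's FK sub-programme; builds on p205010 (kernel
theorem, internal audit signed; external expert review pending).  No definitions, no named facts, no sorries; standard axioms.

**`FK.bridge_case_c`** — `N = BRIDGE(Qac, Qad, Qbc, Qbd, Qcd; a, b)` with at most `n + 1` edges, the inner mark the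
inner skeleton vertex `c`, and THEOREM 𝒯₂(𝒦) known below `n + 1` edges (hypothesis `ih`): every `famP11` member is nonnegative at `(a, b, c)` on
every minor `(E, C)` of `N`, for every nonnegative weight.  STEP 1: each of the five slots with ≥ 2 edges is reduced by
`FK.bridge_oneSided` (`…Pat3KNetBridge`); STEP 2: otherwise they are their virtual edges (`FK.IsKNet.eq_singleton_of_card_le_one`);
STEP 3: a virtual edge outside `E ∪ C` is deleted — a minor of `FK.IsKNet.bridge_erase_*`, fewer edges, `ih`; STEP 4: virtual edges in
`E ∩ C` are doubled away (`FK.mval2C_nonneg_of_sdiff`); STEP 5: the K-STATE LEAF `FK.bridgeB0Kc_famP11_level_nonneg` (`…Pat3BridgeLeafK`,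
names `![a, b, c, d]`, state `(L, K)` read off `(E, C)` by `FK.filter_mem_splits`; no piece).
The placement `s = d` follows by the symmetry `c ↔ d`; the slots are `…Pat3KNetCaseAC / …CaseCD`; the induction is `…Pat3KNetT2`.
[cite: AyyerLinussonRavichandran2025, §7 (p. 22)] [cite: Grimmett2006, §3.9 (pp. 63–64)]
-/

namespace Summit.CriticalPhenomena.PercolationContinuityZ3.Theorems

namespace FK

open SimpleGraph Literature.Probability.LatticeModels Literature.Probability.Percolation
open scoped Classical

variable {V : Type*}

/-! ### The leaf placement `s = c` (row B0 in all K-states) -/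

section CaseC

variable [Fintype V] {n : ℕ}

/-- **BRIDGE CASE, THE MARK AT THE INNER VERTEX `c`.**  Given the induction hypothesis below `n + 1` edges: every `famP11` member is
nonnegative (every nonnegative weight) at `(a, b, c)` on every minor `(E, C)` of `BRIDGE(Qac, Qad, Qbc, Qbd, Qcd; a, b)` with at most
`n + 1` edges.  One-sided reductions of all five slots; deleted plain slots by `ih` on `FK.IsKNet.bridge_erase_*`; doubled plain
slots; then the K-state leaf `FK.bridgeB0Kc_famP11_level_nonneg` (the explicit minors of `K₄ − ab`). [cite: AyyerLinussonRavichandran2025, §7 (p. 22)] -/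
theorem bridge_case_c
    (ih : ∀ ⦃N : Finset (Sym2 V)⦄ ⦃x y : V⦄, N.card ≤ n → IsKNet N x y → ∀ E C : Finset (Sym2 V), E ⊆ N → C ⊆ N →
      ∀ s : V, (∃ e ∈ N, s ∈ e) → s ≠ x → s ≠ y → ∀ w : ℕ → ℝ, (∀ k, 0 ≤ w k) → ∀ i : ℕ, 0 ≤ mval2C w E C x y s (famGet famP11 i))
    {Qac Qad Qbc Qbd Qcd : Finset (Sym2 V)} {a b c d : V}
    (hac : IsKNet Qac a c) (had : IsKNet Qad a d) (hbc : IsKNet Qbc b c) (hbd : IsKNet Qbd b d) (hcd : IsKNet Qcd c d)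
    (hsep : BridgeSep Qac Qad Qbc Qbd Qcd a b c d) (hcard : (Qac ∪ Qad ∪ Qbc ∪ Qbd ∪ Qcd).card ≤ n + 1)
    {E C : Finset (Sym2 V)} (hE : E ⊆ Qac ∪ Qad ∪ Qbc ∪ Qbd ∪ Qcd) (hC : C ⊆ Qac ∪ Qad ∪ Qbc ∪ Qbd ∪ Qcd)
    (w : ℕ → ℝ) (hw : ∀ k, 0 ≤ w k) (i : ℕ) : 0 ≤ mval2C w E C a b c (famGet famP11 i) := by
  -- distinctness of the skeleton vertices
  have hab : a ≠ b := fun h => hbc.ne (hsep.v_ac_bc b (h ▸ hac.left_mem) hbc.left_mem)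
  have hca : c ≠ a := hac.ne.symm
  have hcb : c ≠ b := hbc.ne.symm
  have hceq := hsep.card_eq
  have c1 := hac.card_pos; have c2 := had.card_pos; have c3 := hbc.card_pos; have c4 := hbd.card_pos; have c5 := hcd.card_pos
  -- STEP 1: one-sided reduction of every slot with at least two edges
  by_cases hac2 : 2 ≤ Qac.card
  · have eN : Qac ∪ Qad ∪ Qbc ∪ Qbd ∪ Qcd = (Qad ∪ Qbc ∪ Qbd ∪ Qcd) ∪ Qac := by
      ac_rfl
    have eN' : (Qad ∪ Qbc ∪ Qbd ∪ Qcd) ∪ {s(a, c)} = {s(a, c)} ∪ Qad ∪ Qbc ∪ Qbd ∪ Qcd := by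
      ac_rfl
    have hR : (Qad ∪ Qbc ∪ Qbd ∪ Qcd).card + 1 ≤ n := by
      have := Finset.card_union_le (Qad ∪ Qbc ∪ Qbd) Qcd; have := Finset.card_union_le (Qad ∪ Qbc) Qbd
      have := Finset.card_union_le Qad Qbc; omega
    have hN' : IsKNet ((Qad ∪ Qbc ∪ Qbd ∪ Qcd) ∪ {s(a, c)}) a b := by
      rw [eN']; exact IsKNet.bridge_shrink_ac hac had hbc hbd hcd hsep
    rw [eN] at hE hC
    refine mval2C_nonneg_of_lev2C (fun μ => bridge_oneSided ih (R := Qad ∪ Qbc ∪ Qbd ∪ Qcd) (Q := Qac) ?_ ?_ hac ?_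
      hN' hR (fun _ => Or.inl rfl) (fun h => Or.inr (hsep.v_ac_bc b h hbc.left_mem)) (fun _ => Or.inr rfl)
      (by obtain ⟨e, he, hce⟩ := hbc.right_mem; exact ⟨e, by simp only [Finset.mem_union]; exact Or.inl (Or.inl (Or.inr he)), hce⟩) hca hcb hE hC i μ) hw
    · exact Finset.disjoint_union_left.2 ⟨Finset.disjoint_union_left.2 ⟨Finset.disjoint_union_left.2
        ⟨hsep.d_ac_ad.symm, hsep.d_ac_bc.symm⟩, hsep.d_ac_bd.symm⟩, hsep.d_ac_cd.symm⟩
    · intro z hz hzQ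
      obtain ⟨e, he, hze⟩ := hz
      simp only [Finset.mem_union] at he
      rcases he with ((he | he) | he) | he
      · exact Or.inl (hsep.v_ac_ad z hzQ ⟨e, he, hze⟩)
      · exact Or.inr (hsep.v_ac_bc z hzQ ⟨e, he, hze⟩)
      · exact (hsep.v_ac_bd z hzQ ⟨e, he, hze⟩).elim
      · exact Or.inr (hsep.v_ac_cd z hzQ ⟨e, he, hze⟩)
    · intro h
      simp only [Finset.mem_union] at h
      rcases h with ((h | h) | h) | h
      · exact hac.ne (hsep.v_ac_ad c hac.right_mem ⟨_, h, Sym2.mem_mk_right _ _⟩).symm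
      · exact hac.ne (hsep.v_ac_bc a hac.left_mem ⟨_, h, Sym2.mem_mk_left _ _⟩)
      · exact hsep.v_ac_bd a hac.left_mem ⟨_, h, Sym2.mem_mk_left _ _⟩
      · exact hac.ne (hsep.v_ac_cd a hac.left_mem ⟨_, h, Sym2.mem_mk_left _ _⟩)
  by_cases had2 : 2 ≤ Qad.card
  · have eN : Qac ∪ Qad ∪ Qbc ∪ Qbd ∪ Qcd = (Qac ∪ Qbc ∪ Qbd ∪ Qcd) ∪ Qad := by
      ac_rfl
    have eN' : (Qac ∪ Qbc ∪ Qbd ∪ Qcd) ∪ {s(a, d)} = Qac ∪ {s(a, d)} ∪ Qbc ∪ Qbd ∪ Qcd := by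
      ac_rfl
    have hR : (Qac ∪ Qbc ∪ Qbd ∪ Qcd).card + 1 ≤ n := by
      have := Finset.card_union_le (Qac ∪ Qbc ∪ Qbd) Qcd; have := Finset.card_union_le (Qac ∪ Qbc) Qbd
      have := Finset.card_union_le Qac Qbc; omega
    have hN' : IsKNet ((Qac ∪ Qbc ∪ Qbd ∪ Qcd) ∪ {s(a, d)}) a b := by
      rw [eN']; exact IsKNet.bridge_shrink_ad hac had hbc hbd hcd hsep
    rw [eN] at hE hC
    refine mval2C_nonneg_of_lev2C (fun μ => bridge_oneSided ih (R := Qac ∪ Qbc ∪ Qbd ∪ Qcd) (Q := Qad) ?_ ?_ had ?_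
      hN' hR (fun _ => Or.inl rfl) (fun h => (hsep.v_ad_bc b h hbc.left_mem).elim) (fun h => Or.inl (hsep.v_ac_ad c hac.right_mem h))
      (by obtain ⟨e, he, hce⟩ := hac.right_mem; exact ⟨e, by simp only [Finset.mem_union]; exact Or.inl (Or.inl (Or.inl he)), hce⟩) hca hcb hE hC i μ) hw
    · exact Finset.disjoint_union_left.2 ⟨Finset.disjoint_union_left.2 ⟨Finset.disjoint_union_left.2
        ⟨hsep.d_ac_ad, hsep.d_ad_bc.symm⟩, hsep.d_ad_bd.symm⟩, hsep.d_ad_cd.symm⟩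
    · intro z hz hzQ
      obtain ⟨e, he, hze⟩ := hz
      simp only [Finset.mem_union] at he
      rcases he with ((he | he) | he) | he
      · exact Or.inl (hsep.v_ac_ad z ⟨e, he, hze⟩ hzQ)
      · exact (hsep.v_ad_bc z hzQ ⟨e, he, hze⟩).elim
      · exact Or.inr (hsep.v_ad_bd z hzQ ⟨e, he, hze⟩)
      · exact Or.inr (hsep.v_ad_cd z hzQ ⟨e, he, hze⟩)
    · intro h
      simp only [Finset.mem_union] at h
      rcases h with ((h | h) | h) | h
      · exact had.ne (hsep.v_ac_ad d ⟨_, h, Sym2.mem_mk_right _ _⟩ had.right_mem).symm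
      · exact hsep.v_ad_bc a had.left_mem ⟨_, h, Sym2.mem_mk_left _ _⟩
      · exact had.ne (hsep.v_ad_bd a had.left_mem ⟨_, h, Sym2.mem_mk_left _ _⟩)
      · exact had.ne (hsep.v_ad_cd a had.left_mem ⟨_, h, Sym2.mem_mk_left _ _⟩)
  by_cases hbc2 : 2 ≤ Qbc.card
  · have eN : Qac ∪ Qad ∪ Qbc ∪ Qbd ∪ Qcd = (Qac ∪ Qad ∪ Qbd ∪ Qcd) ∪ Qbc := by
      ac_rfl
    have eN' : (Qac ∪ Qad ∪ Qbd ∪ Qcd) ∪ {s(b, c)} = Qac ∪ Qad ∪ {s(b, c)} ∪ Qbd ∪ Qcd := by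
      ac_rfl
    have hR : (Qac ∪ Qad ∪ Qbd ∪ Qcd).card + 1 ≤ n := by
      have := Finset.card_union_le (Qac ∪ Qad ∪ Qbd) Qcd; have := Finset.card_union_le (Qac ∪ Qad) Qbd
      have := Finset.card_union_le Qac Qad; omega
    have hN' : IsKNet ((Qac ∪ Qad ∪ Qbd ∪ Qcd) ∪ {s(b, c)}) a b := by
      rw [eN']; exact IsKNet.bridge_shrink_bc hac had hbc hbd hcd hsep
    rw [eN] at hE hC
    refine mval2C_nonneg_of_lev2C (fun μ => bridge_oneSided ih (R := Qac ∪ Qad ∪ Qbd ∪ Qcd) (Q := Qbc) ?_ ?_ hbc ?_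
      hN' hR (fun h => Or.inr (hsep.v_ac_bc a hac.left_mem h)) (fun _ => Or.inl rfl) (fun _ => Or.inr rfl)
      (by obtain ⟨e, he, hce⟩ := hac.right_mem; exact ⟨e, by simp only [Finset.mem_union]; exact Or.inl (Or.inl (Or.inl he)), hce⟩) hca hcb hE hC i μ) hw
    · exact Finset.disjoint_union_left.2 ⟨Finset.disjoint_union_left.2 ⟨Finset.disjoint_union_left.2
        ⟨hsep.d_ac_bc, hsep.d_ad_bc⟩, hsep.d_bc_bd.symm⟩, hsep.d_bc_cd.symm⟩
    · intro z hz hzQ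
      obtain ⟨e, he, hze⟩ := hz
      simp only [Finset.mem_union] at he
      rcases he with ((he | he) | he) | he
      · exact Or.inr (hsep.v_ac_bc z ⟨e, he, hze⟩ hzQ)
      · exact (hsep.v_ad_bc z ⟨e, he, hze⟩ hzQ).elim
      · exact Or.inl (hsep.v_bc_bd z hzQ ⟨e, he, hze⟩)
      · exact Or.inr (hsep.v_bc_cd z hzQ ⟨e, he, hze⟩)
    · intro h
      simp only [Finset.mem_union] at h
      rcases h with ((h | h) | h) | h
      · exact hbc.ne (hsep.v_ac_bc b ⟨_, h, Sym2.mem_mk_left _ _⟩ hbc.left_mem)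
      · exact hsep.v_ad_bc b ⟨_, h, Sym2.mem_mk_left _ _⟩ hbc.left_mem
      · exact hbc.ne (hsep.v_bc_bd c hbc.right_mem ⟨_, h, Sym2.mem_mk_right _ _⟩).symm
      · exact hbc.ne (hsep.v_bc_cd b hbc.left_mem ⟨_, h, Sym2.mem_mk_left _ _⟩)
  by_cases hbd2 : 2 ≤ Qbd.card
  · have eN : Qac ∪ Qad ∪ Qbc ∪ Qbd ∪ Qcd = (Qac ∪ Qad ∪ Qbc ∪ Qcd) ∪ Qbd := by
      ac_rfl
    have eN' : (Qac ∪ Qad ∪ Qbc ∪ Qcd) ∪ {s(b, d)} = Qac ∪ Qad ∪ Qbc ∪ {s(b, d)} ∪ Qcd := by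
      ac_rfl
    have hR : (Qac ∪ Qad ∪ Qbc ∪ Qcd).card + 1 ≤ n := by
      have := Finset.card_union_le (Qac ∪ Qad ∪ Qbc) Qcd; have := Finset.card_union_le (Qac ∪ Qad) Qbc
      have := Finset.card_union_le Qac Qad; omega
    have hN' : IsKNet ((Qac ∪ Qad ∪ Qbc ∪ Qcd) ∪ {s(b, d)}) a b := by
      rw [eN']; exact IsKNet.bridge_shrink_bd hac had hbc hbd hcd hsep
    rw [eN] at hE hC
    refine mval2C_nonneg_of_lev2C (fun μ => bridge_oneSided ih (R := Qac ∪ Qad ∪ Qbc ∪ Qcd) (Q := Qbd) ?_ ?_ hbd ?_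
      hN' hR (fun h => (hsep.v_ac_bd a hac.left_mem h).elim) (fun _ => Or.inl rfl) (fun h => (hsep.v_ac_bd c hac.right_mem h).elim)
      (by obtain ⟨e, he, hce⟩ := hac.right_mem; exact ⟨e, by simp only [Finset.mem_union]; exact Or.inl (Or.inl (Or.inl he)), hce⟩) hca hcb hE hC i μ) hw
    · exact Finset.disjoint_union_left.2 ⟨Finset.disjoint_union_left.2 ⟨Finset.disjoint_union_left.2
        ⟨hsep.d_ac_bd, hsep.d_ad_bd⟩, hsep.d_bc_bd⟩, hsep.d_bd_cd.symm⟩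
    · intro z hz hzQ
      obtain ⟨e, he, hze⟩ := hz
      simp only [Finset.mem_union] at he
      rcases he with ((he | he) | he) | he
      · exact (hsep.v_ac_bd z ⟨e, he, hze⟩ hzQ).elim
      · exact Or.inr (hsep.v_ad_bd z ⟨e, he, hze⟩ hzQ)
      · exact Or.inl (hsep.v_bc_bd z ⟨e, he, hze⟩ hzQ)
      · exact Or.inr (hsep.v_bd_cd z hzQ ⟨e, he, hze⟩)
    · intro h
      simp only [Finset.mem_union] at h
      rcases h with ((h | h) | h) | h
      · exact hsep.v_ac_bd b ⟨_, h, Sym2.mem_mk_left _ _⟩ hbd.left_mem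
      · exact hbd.ne (hsep.v_ad_bd b ⟨_, h, Sym2.mem_mk_left _ _⟩ hbd.left_mem)
      · exact hbd.ne (hsep.v_bc_bd d ⟨_, h, Sym2.mem_mk_right _ _⟩ hbd.right_mem).symm
      · exact hbd.ne (hsep.v_bd_cd b hbd.left_mem ⟨_, h, Sym2.mem_mk_left _ _⟩)
  by_cases hcd2 : 2 ≤ Qcd.card
  · have eN : Qac ∪ Qad ∪ Qbc ∪ Qbd ∪ Qcd = (Qac ∪ Qad ∪ Qbc ∪ Qbd) ∪ Qcd := by
      ac_rfl
    have hR : (Qac ∪ Qad ∪ Qbc ∪ Qbd).card + 1 ≤ n := by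
      have := Finset.card_union_le (Qac ∪ Qad ∪ Qbc) Qbd; have := Finset.card_union_le (Qac ∪ Qad) Qbc
      have := Finset.card_union_le Qac Qad; omega
    have hN' : IsKNet ((Qac ∪ Qad ∪ Qbc ∪ Qbd) ∪ {s(c, d)}) a b := IsKNet.bridge_shrink_cd hac had hbc hbd hcd hsep
    rw [eN] at hE hC
    refine mval2C_nonneg_of_lev2C (fun μ => bridge_oneSided ih (R := Qac ∪ Qad ∪ Qbc ∪ Qbd) (Q := Qcd) ?_ ?_ hcd ?_
      hN' hR (fun h => Or.inl (hsep.v_ac_cd a hac.left_mem h)) (fun h => Or.inl (hsep.v_bc_cd b hbc.left_mem h)) (fun _ => Or.inl rfl)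
      (by obtain ⟨e, he, hce⟩ := hac.right_mem; exact ⟨e, by simp only [Finset.mem_union]; exact Or.inl (Or.inl (Or.inl he)), hce⟩) hca hcb hE hC i μ) hw
    · exact Finset.disjoint_union_left.2 ⟨Finset.disjoint_union_left.2 ⟨Finset.disjoint_union_left.2
        ⟨hsep.d_ac_cd, hsep.d_ad_cd⟩, hsep.d_bc_cd⟩, hsep.d_bd_cd⟩
    · intro z hz hzQ
      obtain ⟨e, he, hze⟩ := hz
      simp only [Finset.mem_union] at he
      rcases he with ((he | he) | he) | he
      · exact Or.inl (hsep.v_ac_cd z ⟨e, he, hze⟩ hzQ)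
      · exact Or.inr (hsep.v_ad_cd z ⟨e, he, hze⟩ hzQ)
      · exact Or.inl (hsep.v_bc_cd z ⟨e, he, hze⟩ hzQ)
      · exact Or.inr (hsep.v_bd_cd z ⟨e, he, hze⟩ hzQ)
    · intro h
      simp only [Finset.mem_union] at h
      rcases h with ((h | h) | h) | h
      · exact hcd.ne (hsep.v_ac_cd d ⟨_, h, Sym2.mem_mk_right _ _⟩ hcd.right_mem).symm
      · exact hcd.ne (hsep.v_ad_cd c ⟨_, h, Sym2.mem_mk_left _ _⟩ hcd.left_mem)
      · exact hcd.ne (hsep.v_bc_cd d ⟨_, h, Sym2.mem_mk_right _ _⟩ hcd.right_mem).symm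
      · exact hcd.ne (hsep.v_bd_cd c ⟨_, h, Sym2.mem_mk_left _ _⟩ hcd.left_mem)
  -- STEP 2: every slot is its virtual edge
  obtain rfl : Qac = {s(a, c)} := hac.eq_singleton_of_card_le_one (by omega)
  obtain rfl : Qad = {s(a, d)} := had.eq_singleton_of_card_le_one (by omega)
  obtain rfl : Qbc = {s(b, c)} := hbc.eq_singleton_of_card_le_one (by omega)
  obtain rfl : Qbd = {s(b, d)} := hbd.eq_singleton_of_card_le_one (by omega)
  obtain rfl : Qcd = {s(c, d)} := hcd.eq_singleton_of_card_le_one (by omega)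
  simp only [Finset.card_singleton] at hceq
  -- STEP 3: a plain slot outside `E ∪ C` is deleted (a minor of the bridge minus that slot)
  by_cases x_ac : s(a, c) ∈ E ∨ s(a, c) ∈ C
  swap
  · have hM := IsKNet.bridge_erase_ac had hbc hbd hcd hsep
    have hNM : ({s(a, c)} ∪ {s(a, d)} ∪ {s(b, c)} ∪ {s(b, d)} ∪ {s(c, d)} : Finset (Sym2 V)) ⊆ insert s(a, c) ({s(a, d)} ∪ {s(b, c)} ∪ {s(b, d)} ∪ {s(c, d)}) :=
      (show ({s(a, c)} ∪ {s(a, d)} ∪ {s(b, c)} ∪ {s(b, d)} ∪ {s(c, d)} : Finset (Sym2 V)) = insert s(a, c) ({s(a, d)} ∪ {s(b, c)} ∪ {s(b, d)} ∪ {s(c, d)}) by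
        rw [Finset.insert_eq]; ac_rfl).le
    have hcM : ({s(a, d)} ∪ {s(b, c)} ∪ {s(b, d)} ∪ {s(c, d)} : Finset (Sym2 V)).card ≤ n := by
      have := Finset.card_union_le ({s(a, d)} ∪ {s(b, c)} ∪ {s(b, d)} : Finset (Sym2 V)) {s(c, d)}
      have := Finset.card_union_le ({s(a, d)} ∪ {s(b, c)} : Finset (Sym2 V)) {s(b, d)}
      have := Finset.card_union_le ({s(a, d)} : Finset (Sym2 V)) {s(b, c)}
      simp only [Finset.card_singleton] at *; omega
    exact ih hcM hM E C ((Finset.subset_insert_iff_of_notMem fun h => x_ac (Or.inl h)).1 (hE.trans hNM))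
      ((Finset.subset_insert_iff_of_notMem fun h => x_ac (Or.inr h)).1 (hC.trans hNM))
      c ⟨s(b, c), by simp only [Finset.mem_union]; exact Or.inl (Or.inl (Or.inr (Finset.mem_singleton_self _))), Sym2.mem_mk_right _ _⟩ hca hcb w hw i
  by_cases x_ad : s(a, d) ∈ E ∨ s(a, d) ∈ C
  swap
  · have hM := IsKNet.bridge_erase_ad hac hbc hbd hcd hsep
    have hNM : ({s(a, c)} ∪ {s(a, d)} ∪ {s(b, c)} ∪ {s(b, d)} ∪ {s(c, d)} : Finset (Sym2 V)) ⊆ insert s(a, d) ({s(a, c)} ∪ {s(b, c)} ∪ {s(b, d)} ∪ {s(c, d)}) :=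
      (show ({s(a, c)} ∪ {s(a, d)} ∪ {s(b, c)} ∪ {s(b, d)} ∪ {s(c, d)} : Finset (Sym2 V)) = insert s(a, d) ({s(a, c)} ∪ {s(b, c)} ∪ {s(b, d)} ∪ {s(c, d)}) by
        rw [Finset.insert_eq]; ac_rfl).le
    have hcM : ({s(a, c)} ∪ {s(b, c)} ∪ {s(b, d)} ∪ {s(c, d)} : Finset (Sym2 V)).card ≤ n := by
      have := Finset.card_union_le ({s(a, c)} ∪ {s(b, c)} ∪ {s(b, d)} : Finset (Sym2 V)) {s(c, d)}
      have := Finset.card_union_le ({s(a, c)} ∪ {s(b, c)} : Finset (Sym2 V)) {s(b, d)}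
      have := Finset.card_union_le ({s(a, c)} : Finset (Sym2 V)) {s(b, c)}
      simp only [Finset.card_singleton] at *; omega
    exact ih hcM hM E C ((Finset.subset_insert_iff_of_notMem fun h => x_ad (Or.inl h)).1 (hE.trans hNM))
      ((Finset.subset_insert_iff_of_notMem fun h => x_ad (Or.inr h)).1 (hC.trans hNM))
      c ⟨s(a, c), by simp only [Finset.mem_union]; exact Or.inl (Or.inl (Or.inl (Finset.mem_singleton_self _))), Sym2.mem_mk_right _ _⟩ hca hcb w hw i
  by_cases x_bc : s(b, c) ∈ E ∨ s(b, c) ∈ C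
  swap
  · have hM := IsKNet.bridge_erase_bc hac had hbd hcd hsep
    have hNM : ({s(a, c)} ∪ {s(a, d)} ∪ {s(b, c)} ∪ {s(b, d)} ∪ {s(c, d)} : Finset (Sym2 V)) ⊆ insert s(b, c) ({s(a, c)} ∪ {s(a, d)} ∪ {s(b, d)} ∪ {s(c, d)}) :=
      (show ({s(a, c)} ∪ {s(a, d)} ∪ {s(b, c)} ∪ {s(b, d)} ∪ {s(c, d)} : Finset (Sym2 V)) = insert s(b, c) ({s(a, c)} ∪ {s(a, d)} ∪ {s(b, d)} ∪ {s(c, d)}) by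
        rw [Finset.insert_eq]; ac_rfl).le
    have hcM : ({s(a, c)} ∪ {s(a, d)} ∪ {s(b, d)} ∪ {s(c, d)} : Finset (Sym2 V)).card ≤ n := by
      have := Finset.card_union_le ({s(a, c)} ∪ {s(a, d)} ∪ {s(b, d)} : Finset (Sym2 V)) {s(c, d)}
      have := Finset.card_union_le ({s(a, c)} ∪ {s(a, d)} : Finset (Sym2 V)) {s(b, d)}
      have := Finset.card_union_le ({s(a, c)} : Finset (Sym2 V)) {s(a, d)}
      simp only [Finset.card_singleton] at *; omega
    exact ih hcM hM E C ((Finset.subset_insert_iff_of_notMem fun h => x_bc (Or.inl h)).1 (hE.trans hNM))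
      ((Finset.subset_insert_iff_of_notMem fun h => x_bc (Or.inr h)).1 (hC.trans hNM))
      c ⟨s(a, c), by simp only [Finset.mem_union]; exact Or.inl (Or.inl (Or.inl (Finset.mem_singleton_self _))), Sym2.mem_mk_right _ _⟩ hca hcb w hw i
  by_cases x_bd : s(b, d) ∈ E ∨ s(b, d) ∈ C
  swap
  · have hM := IsKNet.bridge_erase_bd hac had hbc hcd hsep
    have hNM : ({s(a, c)} ∪ {s(a, d)} ∪ {s(b, c)} ∪ {s(b, d)} ∪ {s(c, d)} : Finset (Sym2 V)) ⊆ insert s(b, d) ({s(a, c)} ∪ {s(a, d)} ∪ {s(b, c)} ∪ {s(c, d)}) :=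
      (show ({s(a, c)} ∪ {s(a, d)} ∪ {s(b, c)} ∪ {s(b, d)} ∪ {s(c, d)} : Finset (Sym2 V)) = insert s(b, d) ({s(a, c)} ∪ {s(a, d)} ∪ {s(b, c)} ∪ {s(c, d)}) by
        rw [Finset.insert_eq]; ac_rfl).le
    have hcM : ({s(a, c)} ∪ {s(a, d)} ∪ {s(b, c)} ∪ {s(c, d)} : Finset (Sym2 V)).card ≤ n := by
      have := Finset.card_union_le ({s(a, c)} ∪ {s(a, d)} ∪ {s(b, c)} : Finset (Sym2 V)) {s(c, d)}
      have := Finset.card_union_le ({s(a, c)} ∪ {s(a, d)} : Finset (Sym2 V)) {s(b, c)}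
      have := Finset.card_union_le ({s(a, c)} : Finset (Sym2 V)) {s(a, d)}
      simp only [Finset.card_singleton] at *; omega
    exact ih hcM hM E C ((Finset.subset_insert_iff_of_notMem fun h => x_bd (Or.inl h)).1 (hE.trans hNM))
      ((Finset.subset_insert_iff_of_notMem fun h => x_bd (Or.inr h)).1 (hC.trans hNM))
      c ⟨s(a, c), by simp only [Finset.mem_union]; exact Or.inl (Or.inl (Or.inl (Finset.mem_singleton_self _))), Sym2.mem_mk_right _ _⟩ hca hcb w hw i
  by_cases x_cd : s(c, d) ∈ E ∨ s(c, d) ∈ C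
  swap
  · have hM := IsKNet.bridge_erase_cd hac had hbc hbd hsep
    have hNM : ({s(a, c)} ∪ {s(a, d)} ∪ {s(b, c)} ∪ {s(b, d)} ∪ {s(c, d)} : Finset (Sym2 V)) ⊆ insert s(c, d) ({s(a, c)} ∪ {s(a, d)} ∪ {s(b, c)} ∪ {s(b, d)}) :=
      (show ({s(a, c)} ∪ {s(a, d)} ∪ {s(b, c)} ∪ {s(b, d)} ∪ {s(c, d)} : Finset (Sym2 V)) = insert s(c, d) ({s(a, c)} ∪ {s(a, d)} ∪ {s(b, c)} ∪ {s(b, d)}) by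
        rw [Finset.insert_eq]; ac_rfl).le
    have hcM : ({s(a, c)} ∪ {s(a, d)} ∪ {s(b, c)} ∪ {s(b, d)} : Finset (Sym2 V)).card ≤ n := by
      have := Finset.card_union_le ({s(a, c)} ∪ {s(a, d)} ∪ {s(b, c)} : Finset (Sym2 V)) {s(b, d)}
      have := Finset.card_union_le ({s(a, c)} ∪ {s(a, d)} : Finset (Sym2 V)) {s(b, c)}
      have := Finset.card_union_le ({s(a, c)} : Finset (Sym2 V)) {s(a, d)}
      simp only [Finset.card_singleton] at *; omega
    exact ih hcM hM E C ((Finset.subset_insert_iff_of_notMem fun h => x_cd (Or.inl h)).1 (hE.trans hNM))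
      ((Finset.subset_insert_iff_of_notMem fun h => x_cd (Or.inr h)).1 (hC.trans hNM))
      c ⟨s(a, c), by simp only [Finset.mem_union]; exact Or.inl (Or.inl (Or.inl (Finset.mem_singleton_self _))), Sym2.mem_mk_right _ _⟩ hca hcb w hw i
  -- STEP 4: plain slots of `E ∩ C` are doubled away
  set P5 : Finset (Sym2 V) := {s(a, c), s(a, d), s(b, c), s(b, d), s(c, d)} with hP5
  have hNP : ∀ e ∈ ({s(a, c)} ∪ {s(a, d)} ∪ {s(b, c)} ∪ {s(b, d)} ∪ {s(c, d)} : Finset (Sym2 V)), e ∈ P5 := by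
    intro e he
    simp only [Finset.mem_union, Finset.mem_singleton] at he
    simp only [hP5, Finset.mem_insert, Finset.mem_singleton]
    rcases he with (((h | h) | h) | h) | h
    exacts [Or.inl h, Or.inr (Or.inl h), Or.inr (Or.inr (Or.inl h)), Or.inr (Or.inr (Or.inr (Or.inl h))), Or.inr (Or.inr (Or.inr (Or.inr h)))]
  have hPEC : ∀ e ∈ P5, e ∈ E ∨ e ∈ C := by
    intro e he
    simp only [hP5, Finset.mem_insert, Finset.mem_singleton] at he
    rcases he with rfl | rfl | rfl | rfl | rfl
    exacts [x_ac, x_ad, x_bc, x_bd, x_cd]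
  refine mval2C_nonneg_of_sdiff w (D := C ∩ P5) Finset.inter_subset_left a b c _ ?_
  set E' : Finset (Sym2 V) := E \ (C ∩ P5) with hE'
  -- STEP 5: the K-state leaf B0 (mark `c`)
  set p : Fin 4 → V := ![a, b, c, d] with hp
  have hinj : Function.Injective p := injective_vec4 hab hac.ne had.ne hbc.ne hbd.ne hcd.ne
  have hPS : plainSet p skelB0 = P5 := by
    ext e
    rw [mem_plainSet_iff]
    simp only [skelB0, List.mem_cons, List.not_mem_nil, or_false, hP5, Finset.mem_insert, Finset.mem_singleton, pedge]
    constructor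
    · rintro ⟨e₀, he₀, rfl⟩
      rcases he₀ with rfl | rfl | rfl | rfl | rfl <;> simp [hp]
    · rintro (rfl | rfl | rfl | rfl | rfl)
      exacts [⟨(0, 2), Or.inl rfl, rfl⟩, ⟨(0, 3), Or.inr (Or.inl rfl), rfl⟩, ⟨(1, 2), Or.inr (Or.inr (Or.inl rfl)), rfl⟩,
        ⟨(1, 3), Or.inr (Or.inr (Or.inr (Or.inl rfl))), rfl⟩, ⟨(2, 3), Or.inr (Or.inr (Or.inr (Or.inr rfl))), rfl⟩]
  have hLK : (skelB0.filter (fun e => decide (pedge p e ∈ E')), skelB0.filter (fun e => decide (pedge p e ∈ C))) ∈ splits skelB0 := by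
    refine filter_mem_splits skelB0 _ _ fun e₀ he₀ => ?_
    have hP : pedge p e₀ ∈ P5 := by rw [← hPS]; exact (mem_plainSet_iff p skelB0 _).2 ⟨e₀, he₀, rfl⟩
    by_cases hc : pedge p e₀ ∈ C
    · have hn : pedge p e₀ ∉ E' := fun h => (Finset.mem_sdiff.1 h).2 (Finset.mem_inter.2 ⟨hc, hP⟩)
      simp [hc, hn]
    · have hy : pedge p e₀ ∈ E' := Finset.mem_sdiff.2 ⟨(hPEC _ hP).resolve_right hc, fun h => hc (Finset.mem_inter.1 h).1⟩
      simp [hc, hy]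
  have hleaf := fun n' ν => bridgeB0Kc_famP11_level_nonneg hinj hLK n' ν
  -- reading the leaf back on `(E', C)`
  have hE'N : E' ⊆ {s(a, c)} ∪ {s(a, d)} ∪ {s(b, c)} ∪ {s(b, d)} ∪ {s(c, d)} := Finset.sdiff_subset.trans hE
  have hEeq : plainSet p (skelB0.filter fun e => decide (pedge p e ∈ E')) = E' := by
    ext e
    rw [mem_plainSet_filter]
    constructor
    · rintro ⟨e₀, _, hf, rfl⟩
      exact of_decide_eq_true hf
    · intro h
      have hP : e ∈ plainSet p skelB0 := by rw [hPS]; exact hNP e (hE'N h)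
      obtain ⟨e₀, he₀, rfl⟩ := (mem_plainSet_iff p skelB0 e).1 hP
      exact ⟨e₀, he₀, decide_eq_true h, rfl⟩
  have hCeq : plainSet p (skelB0.filter fun e => decide (pedge p e ∈ C)) = C := by
    ext e
    rw [mem_plainSet_filter]
    constructor
    · rintro ⟨e₀, _, hf, rfl⟩
      exact of_decide_eq_true hf
    · intro h
      have hP : e ∈ plainSet p skelB0 := by rw [hPS]; exact hNP e (hC h)
      obtain ⟨e₀, he₀, rfl⟩ := (mem_plainSet_iff p skelB0 e).1 hP
      exact ⟨e₀, he₀, decide_eq_true h, rfl⟩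
  refine mval2C_nonneg_of_lev2C (fun μ => ?_) hw
  have h := hleaf i μ
  rw [hEeq, hCeq] at h
  exact h

end CaseC

end FK

end Summit.CriticalPhenomena.PercolationContinuityZ3.Theorems
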